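import Mathlib
import HarnessLib
import Summits.KontsevichZagierPeriods.KontsevichZagierPeriods.Theses.LinRedNormalForm
import Summits.KontsevichZagierPeriods.KontsevichZagierPeriods.Theorems.MzvKernelInKZTwoPosetsCubicalChart
import Summits.KontsevichZagierPeriods.KontsevichZagierPeriods.Theorems.MzvKernelInKZ.Negative.Divergence

/-!
# Crux `DihedralNormalForm` (stmt-KontsevichZagierPeriods-3912), line `torus-descent-sum-shadow`: `stub_wordAtomChart`

The EXIT of the line. A WORD ATOM of dimension `k` is the MZV word representation
`[Δ_k, q · ∏ᵢ ω_{εᵢ}(tᵢ)]` (`ω_true(t) = 1/(1 − t)`, `ω_false(t) = 1/t`) read in the cubical chart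
`tᵢ = x₀ x₁ ⋯ xᵢ` of the open ordered simplex: a representation on the open cube `(0,1)ᵏ` with
integrand `q · (∏ᵢ xᵢ^{k−1−i}) · ∏ᵢ ω_{εᵢ}(x₀ ⋯ xᵢ)` (the first product is the Jacobian of the
chart). We show that every such representation is congruent modulo `KZ.relations` to a
`ℤ`-combination of the crux's generators (MZV word representations on the simplex,
`MzvKernelInKZ.Negative.genSet` verbatim):

* the word-atom integrand is, letter by letter, the cubical pull-back `TwoPosets.cubicalFun ε q`
  of the two-posets line (`wordAtomChart_integrand_eq_cubicalFun`, `Finset.prod_filter`);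
* for ADMISSIBLE letters (`Negative.Adm ε`) the cubical chart theorem
  `TwoPosets.stub_cubicalChart` (ONE change-of-variables move, Kontsevich–Zagier's rule (2), along
  the polynomial bijection `(0,1)ᵏ → Δ_k` with triangular Jacobian `∏ⱼ xⱼ^{k−1−j}`) identifies the
  atom with the canonical word representation `Negative.wordRep ε q hε ∈ genSet`;
* for NON-ADMISSIBLE letters the coefficient `q` must vanish: absolute integrability on the cube
  transports along the chart (`MeasureTheory.integrableOn_image_iff_integrableOn_abs_det_fderiv_smul`,
  `wordAtomChart_integrableOn_image`) to absolute integrability of `q · ∏ ω_ε` on the simplex, which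
  fails for `q ≠ 0` (`Negative.not_integrableOn_wordFun`); a representation with zero integrand is
  a relation (`Negative.of_mem_relations_of_eqOn_zero`), so `m = 0` works.

References: M. Kontsevich, D. Zagier, *Periods* (2001), §1.1 (iterated-integral representation of
MZVs, convergence exactly for admissible words), §1.2 rule (2); F. Brown, *Multiple zeta values
and periods of moduli spaces* (2009), §2 (cubical coordinates).
-/

noncomputable section

open MeasureTheory Set
open Literature.NumberTheory.Transcendental

namespace Summit.KontsevichZagierPeriods.DihedralNormalForm.TorusDescent

open Summit.KontsevichZagierPeriods.MzvKernelInKZ.Negative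
open Summit.KontsevichZagierPeriods.MzvKernelInKZ.TwoPosets
open Summit.KontsevichZagierPeriods.FurushoPentagon.HoffmanRelationInKZ
  (hasFDerivAt_monomialChart det_monomialChart)

variable {k : ℕ}

/-- **The word-atom integrand is the cubical pull-back** `cubicalFun ε q` of the word integrand
`q · ∏ ω_ε` along `tᵢ = x₀ ⋯ xᵢ` (everywhere, not only on the cube): the partial products
`∏_{l ≤ i} x_l` are `TwoPosets.pprod x i` (`Finset.prod_filter`). -/
theorem wordAtomChart_integrand_eq_cubicalFun (ε : Fin k → Bool) (q : ℚ) (x : Fin k → ℝ) :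
    (q : ℝ) * ((∏ i : Fin k, x i ^ (k - 1 - (i : ℕ))) * ∏ i : Fin k,
      if ε i then 1 / (1 - (∏ l : Fin k, if l ≤ i then x l else 1))
      else 1 / (∏ l : Fin k, if l ≤ i then x l else 1)) = cubicalFun ε q x := by
  simp only [cubicalFun, wordFun, cubicalMap, pprod, Finset.prod_filter]
  ring

/-- **Integrability transports forward along a monomial chart.** For a monomial chart
`C y = (∏_{j ∈ S i} y_j)_i` with rows supported on `j ≤ i` and containing the diagonal, injective
on a measurable `D`: if `g = (h ∘ C) · |Jac C|` on `D` is integrable on `D`, then `h` is integrable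
on `C '' D` (`MeasureTheory.integrableOn_image_iff_integrableOn_abs_det_fderiv_smul`, the
Jacobian determinant being `∏ᵢ ∏_{k ∈ S i, k ≠ i} y_k`, `det_monomialChart`). -/
theorem wordAtomChart_integrableOn_image {N : ℕ} (S : Fin N → Finset (Fin N))
    (hS : ∀ i, ∀ j ∈ S i, j ≤ i) (hS' : ∀ i, i ∈ S i) {D : Set (Fin N → ℝ)}
    (hD : MeasurableSet D) (C : (Fin N → ℝ) → (Fin N → ℝ)) (hC : ∀ y i, C y i = ∏ j ∈ S i, y j)
    (hinj : InjOn C D) (g h : (Fin N → ℝ) → ℝ)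
    (hgh : ∀ y ∈ D, g y = h (C y) * |∏ i, ∏ k ∈ (S i).erase i, y k|)
    (hg : IntegrableOn g D volume) : IntegrableOn h (C '' D) volume := by
  obtain rfl : C = fun y i => ∏ j ∈ S i, y j := funext fun y => funext fun i => hC y i
  rw [integrableOn_image_iff_integrableOn_abs_det_fderiv_smul volume hD
    (fun y _ => (hasFDerivAt_monomialChart S y).hasFDerivWithinAt) hinj]
  refine hg.congr_fun (fun y hy => ?_) hD
  rw [det_monomialChart S hS hS', smul_eq_mul, mul_comm]
  exact hgh y hy

/-- **Integrability on the cube forces integrability on the simplex.** If the cubical pull-back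
`cubicalFun ε q` is absolutely integrable on the open cube, then the word integrand `q · ∏ ω_ε` is
absolutely integrable on the open ordered simplex (transport along the cubical chart
`tᵢ = x₀ ⋯ xᵢ`, a bijection `(0,1)ᵏ → Δ_k` with Jacobian `∏ⱼ xⱼ^{k−1−j}`). -/
theorem wordAtomChart_integrableOn_wordFun (ε : Fin k → Bool) (q : ℚ)
    (h : IntegrableOn (cubicalFun ε q) (cube k) volume) :
    IntegrableOn (wordFun ε q) (simplex k) volume := by
  have hS : ∀ i : Fin k, ∀ j ∈ Finset.univ.filter (fun j => j ≤ i), j ≤ i := fun i j hj =>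
    (Finset.mem_filter.mp hj).2
  have hS' : ∀ i : Fin k, i ∈ Finset.univ.filter (fun j => j ≤ i) := fun i =>
    Finset.mem_filter.mpr ⟨Finset.mem_univ _, le_rfl⟩
  have hm : MeasurableSet (cube k) :=
    Literature.ModelTheory.ExponentialFields.IsSemialgebraic.measurableSet_holds (isSemialgebraic_cube k)
  have himg := wordAtomChart_integrableOn_image (fun i : Fin k => Finset.univ.filter (fun j => j ≤ i))
    hS hS' hm (cubicalMap k) (fun _ _ => rfl) (injOn_cubicalMap k)
    (cubicalFun ε q) (wordFun ε q) (fun y hy => cubicalFun_eq_mul_abs_jacobian ε q hy) h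
  rwa [image_cubicalMap] at himg

/-- **Non-admissible word atoms have coefficient zero**: if a representation on the open cube has
the word-atom integrand (equivalently `cubicalFun ε q`) with NON-admissible letters, then `q = 0`
(otherwise `q · ∏ ω_ε` would be absolutely integrable on the simplex, contradicting
`Negative.not_integrableOn_wordFun`). Kontsevich–Zagier 2001, §1.1. -/
theorem wordAtomChart_eq_zero_of_not_adm {ε : Fin k → Bool} {q : ℚ} (s : KZ.IntegralRep k)
    (hd : s.domain = cube k) (hi : EqOn s.integrand (cubicalFun ε q) (cube k)) (hε : ¬ Adm ε) :
    q = 0 := by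
  by_contra hq
  refine not_integrableOn_wordFun hε hq (wordAtomChart_integrableOn_wordFun ε q ?_)
  have h1 : IntegrableOn s.integrand (cube k) volume := hd ▸ s.integrableOn
  exact h1.congr_fun hi
    (Literature.ModelTheory.ExponentialFields.IsSemialgebraic.measurableSet_holds (isSemialgebraic_cube k))

/-- **stub_wordAtomChart** (EXIT of the line `torus-descent-sum-shadow`). The inverse cubical
chart `x ↦ t`, `tᵢ = x₀ ⋯ xᵢ` (rule (2): polynomial, injective on the open cube, Jacobian
`∏ xᵢ^{k−1−i}`, image the open ordered simplex) identifies a word atom with the MZV word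
representation `[Δ_k, q · ∏ ω_{εᵢ}(tᵢ)]` of the crux's target set: for admissible letters by
`TwoPosets.stub_cubicalChart` (`m = [wordRep ε q]`), for non-admissible letters the coefficient
vanishes (`wordAtomChart_eq_zero_of_not_adm`) and the atom is itself a relation (`m = 0`).
Kontsevich–Zagier 2001, §1.2 rule (2). -/
theorem stub_wordAtomChart : ∀ (k : ℕ) (q : ℚ) (ε : Fin k → Bool) (s : Literature.NumberTheory.Transcendental.KZ.IntegralRep k), s.domain = {x : Fin k → ℝ | ∀ i, x i ∈ Set.Ioo (0:ℝ) 1} → Set.EqOn s.integrand (fun x => (q : ℝ) * ((∏ i : Fin k, x i ^ (k - 1 - (i : ℕ))) * ∏ i : Fin k, if ε i then 1 / (1 - (∏ l : Fin k, if l ≤ i then x l else 1)) else 1 / (∏ l : Fin k, if l ≤ i then x l else 1))) s.domain → ∃ m ∈ AddSubgroup.closure {x : Literature.NumberTheory.Transcendental.KZ.FormalRep | ∃ (w : ℕ) (ε : Fin w → Bool) (q : ℚ) (s : Literature.NumberTheory.Transcendental.KZ.IntegralRep w), s.domain = {t | (∀ i, 0 < t i) ∧ (∀ i, t i < 1) ∧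 StrictAnti t} ∧ Set.EqOn s.integrand (fun t => (q : ℝ) * ∏ i, if ε i then 1 / (1 - t i) else 1 / t i) s.domain ∧ x = Literature.NumberTheory.Transcendental.KZ.of s}, Literature.NumberTheory.Transcendental.KZ.of s - m ∈ Literature.NumberTheory.Transcendental.KZ.relations := by
  intro k q ε s hdom hint
  have hdom' : s.domain = cube k := hdom
  have hint' : EqOn s.integrand (cubicalFun ε q) (cube k) := fun x hx =>
    (hint (hdom' ▸ hx : x ∈ s.domain)).trans (wordAtomChart_integrand_eq_cubicalFun ε q x)
  by_cases hε : Adm ε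
  · refine ⟨KZ.of (wordRep ε q hε), of_wordRep_mem_closure ε q hε, ?_⟩
    rw [← neg_sub]
    exact neg_mem ((stub_cubicalChart k ε hε q).2 s hdom' hint')
  · have hq : q = 0 := wordAtomChart_eq_zero_of_not_adm s hdom' hint' hε
    subst hq
    refine ⟨0, zero_mem _, ?_⟩
    rw [sub_zero]
    exact of_mem_relations_of_eqOn_zero s fun x hx => by
      rw [hint hx]
      simp

end Summit.KontsevichZagierPeriods.DihedralNormalForm.TorusDescent

end
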